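import Summits.Ventures.LatticeQCDFlow.Scaling.ClockConditionedMixingTime

/-!
HONEST FRAMING: exact (Metropolis-corrected) sampling algorithms for lattice gauge theory; figures
of merit are autocorrelation/cost numbers at stated couplings and volumes; no continuum-physics
claim.

# ClockConditionedSelfContained — THE CLOCK-CONDITIONED STEP LAW WITH EVERY AUXILIARY OBJECT DISCHARGED: THE RENEWAL SEQUENCE EXISTS (WELL-FOUNDED RECURSION), THE POWERS `Sⁿ`, `Aⁿ`
# ARE CONSTRUCTED, SO THE USER SUPPLIES ONLY `A`, `B`, `σ`, THE CYCLE KERNELS `C_j = AʲB`, THE COST `ρ` AND THE PER-ATTEMPT-COUNT RATES (lean-2 GEN-39, ours)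

Venture-side (OURS).  Cell `lqcd-flow` (pub-lqcd), unit `pub-lqcd-lean-2-g39`, 2026-08-30.  Chapter Y, file C4 — plumbing for files C1–C3.  The renewal sequence
`u_n = Σ_{j<n}σʲ(1−σ)(1−r_j)u_{n−1−j} + σⁿ` is a course-of-values recursion; here it is produced once (`clock_renewal_exists`, `WellFounded.fix` on `<`), and the matrix powers are
produced by primitive recursion inside the proofs, so that the step-count law reads with the minimal data:

* `clock_renewal_exists`;
* **`clock_worstTvDist_le'`**: `d_S(n) ≤ D·((1−r̃)ᵏ + (2ᵏ⁺¹−1)((1+σ)/2)ⁿ)` for every `k, n`;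
* **`clock_mixingTime_le'`**: `t_mix^S(ε) ≤ ⌈(2/(1−σ))(−log ε + log D + (k+2)log 2)⌉₊` for every natural `k ≥ (−log ε + log 2D)/r̃`.

Hypotheses left to the user: `A, B ≥ 0` with unit row sums, `0 ≤ σ < 1`, `S = σA + (1−σ)B`, the cycle kernels by their recursion (`C_0 = B`, `C_{j+1} = A·C_j`), a cost `ρ` with `ρ(x,x) = 0`,
`1 ≤ ρ(x,y) ≤ D` off the diagonal, rates `r_j ∈ [0,1]` with `Σ_{j<n}σʲ(1−σ)(1−r_j) ≤ 1 − r̃` (`0 < r̃ ≤ 1`), the per-attempt-count contraction `ρ_K(C_j(x,·),C_j(y,·)) ≤ (1−r_j)ρ(x,y)`, and a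
stationary probability vector `π`.  Literature grade (cell rule): OWN, plumbing; nothing cited; no new bib keys.
-/

open Finset
open Literature.Probability.MarkovChains

namespace Summit.Ventures.LatticeQCDFlow.Scaling

section ClockSelf
variable {X : Type*} [Fintype X] [DecidableEq X]
variable {A B S : X → X → ℝ} {σ : ℝ} {C : ℕ → X → X → ℝ} {ρ : X → X → ℝ} {r : ℕ → ℝ} {D rt : ℝ} {π : X → ℝ}

omit [Fintype X] [DecidableEq X] in
/-- **The renewal sequence exists:** for every `σ` and `r` there is `u : ℕ → ℝ` with `u_n = Σ_{j<n}σʲ(1−σ)(1−r_j)u_{n−1−j} + σⁿ` for all `n`. [ours] -/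
theorem clock_renewal_exists (σ : ℝ) (r : ℕ → ℝ) :
    ∃ u : ℕ → ℝ, ∀ n, u n = (∑ j ∈ range n, σ ^ j * (1 - σ) * (1 - r j) * u (n - 1 - j)) + σ ^ n := by
  let F : (n : ℕ) → ((k : ℕ) → k < n → ℝ) → ℝ :=
    fun n ih => (∑ j : Fin n, σ ^ (j : ℕ) * (1 - σ) * (1 - r j) * ih (n - 1 - j) (by have := j.2; omega)) + σ ^ n
  let u : ℕ → ℝ := WellFounded.fix wellFounded_lt F
  refine ⟨u, fun n => ?_⟩
  have h : u n = F n (fun k _ => u k) := WellFounded.fix_eq wellFounded_lt F n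
  rw [h]
  show (∑ j : Fin n, σ ^ (j : ℕ) * (1 - σ) * (1 - r j) * u (n - 1 - j)) + σ ^ n = _
  rw [← Finset.sum_range (fun j => σ ^ j * (1 - σ) * (1 - r j) * u (n - 1 - j))]

/-- **`d_S(n) ≤ D·((1−r̃)ᵏ + (2ᵏ⁺¹−1)((1+σ)/2)ⁿ)`, self-contained.** [ours] -/
theorem clock_worstTvDist_le' (hA0 : ∀ x y, 0 ≤ A x y) (hA1 : ∀ x, ∑ y, A x y = 1) (hB0 : ∀ x y, 0 ≤ B x y) (hB1 : ∀ x, ∑ y, B x y = 1)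
    (hσ0 : 0 ≤ σ) (hσ1 : σ < 1) (hS : ∀ x y, S x y = σ * A x y + (1 - σ) * B x y)
    (hC0 : ∀ x y, C 0 x y = B x y) (hCs : ∀ j x y, C (j + 1) x y = ∑ z, A x z * C j z y)
    (hρd : ∀ x, ρ x x = 0) (hρ1 : ∀ x y, x ≠ y → 1 ≤ ρ x y) (hρD : ∀ x y, ρ x y ≤ D)
    (hr0 : ∀ j, 0 ≤ r j) (hr1 : ∀ j, r j ≤ 1) (hrt1 : rt ≤ 1) (hmean : ∀ n, ∑ j ∈ range n, σ ^ j * (1 - σ) * (1 - r j) ≤ 1 - rt)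
    (hcontr : ∀ j x y, transportDist ρ (C j x) (C j y) ≤ (1 - r j) * ρ x y)
    (hπ0 : ∀ x, 0 ≤ π x) (hπ1 : ∑ x, π x = 1) (hπS : IsStationary π S) (k n : ℕ) :
    worstTvDist S π n ≤ D * ((1 - rt) ^ k + (2 ^ (k + 1) - 1) * ((1 + σ) / 2) ^ n) := by
  classical
  obtain ⟨u, hu⟩ := clock_renewal_exists σ r
  let Sn : ℕ → X → X → ℝ := fun n => Nat.rec (fun x y => if x = y then (1:ℝ) else 0) (fun _ M => fun x y => ∑ z, S x z * M z y) n
  let An : ℕ → X → X → ℝ := fun n => Nat.rec (fun x y => if x = y then (1:ℝ) else 0) (fun _ M => fun x y => ∑ z, A x z * M z y) n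
  exact clock_worstTvDist_le_explicit hA0 hA1 hB0 hB1 hσ0 hσ1 hS (Sn := Sn) (fun _ _ => rfl) (fun _ _ _ => rfl) (An := An) (fun _ _ => rfl) (fun _ _ _ => rfl)
    hC0 hCs hρd hρ1 hρD hr0 hr1 hrt1 hmean hcontr hu hπ0 hπ1 hπS k n

/-- **`t_mix^S(ε) ≤ ⌈(2/(1−σ))(−log ε + log D + (k+2)log 2)⌉₊` for every natural `k ≥ (−log ε + log 2D)/r̃`, self-contained** — order `log(D/ε)/((1−σ)r̃)`. [ours] -/
theorem clock_mixingTime_le' (hA0 : ∀ x y, 0 ≤ A x y) (hA1 : ∀ x, ∑ y, A x y = 1) (hB0 : ∀ x y, 0 ≤ B x y) (hB1 : ∀ x, ∑ y, B x y = 1)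
    (hσ0 : 0 ≤ σ) (hσ1 : σ < 1) (hS : ∀ x y, S x y = σ * A x y + (1 - σ) * B x y)
    (hC0 : ∀ x y, C 0 x y = B x y) (hCs : ∀ j x y, C (j + 1) x y = ∑ z, A x z * C j z y)
    (hρd : ∀ x, ρ x x = 0) (hρ1 : ∀ x y, x ≠ y → 1 ≤ ρ x y) (hρD : ∀ x y, ρ x y ≤ D) (hDpos : 0 < D)
    (hr0 : ∀ j, 0 ≤ r j) (hr1 : ∀ j, r j ≤ 1) (hrt0 : 0 < rt) (hrt1 : rt ≤ 1) (hmean : ∀ n, ∑ j ∈ range n, σ ^ j * (1 - σ) * (1 - r j) ≤ 1 - rt)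
    (hcontr : ∀ j x y, transportDist ρ (C j x) (C j y) ≤ (1 - r j) * ρ x y)
    (hπ0 : ∀ x, 0 ≤ π x) (hπ1 : ∑ x, π x = 1) (hπS : IsStationary π S) {ε : ℝ} (hε : 0 < ε) {k : ℕ}
    (hk : (-Real.log ε + Real.log (2 * D)) / rt ≤ k) :
    mixingTime S π ε ≤ ⌈2 / (1 - σ) * (-Real.log ε + Real.log D + (k + 2) * Real.log 2)⌉₊ := by
  classical
  obtain ⟨u, hu⟩ := clock_renewal_exists σ r
  let Sn : ℕ → X → X → ℝ := fun n => Nat.rec (fun x y => if x = y then (1:ℝ) else 0) (fun _ M => fun x y => ∑ z, S x z * M z y) n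
  let An : ℕ → X → X → ℝ := fun n => Nat.rec (fun x y => if x = y then (1:ℝ) else 0) (fun _ M => fun x y => ∑ z, A x z * M z y) n
  exact clock_mixingTime_le hA0 hA1 hB0 hB1 hσ0 hσ1 hS (Sn := Sn) (fun _ _ => rfl) (fun _ _ _ => rfl) (An := An) (fun _ _ => rfl) (fun _ _ _ => rfl)
    hC0 hCs hρd hρ1 hρD hDpos hr0 hr1 hrt0 hrt1 hmean hcontr hu hπ0 hπ1 hπS hε hk

end ClockSelf

end Summit.Ventures.LatticeQCDFlow.Scaling
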